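import Literature.MeasureTheory.RestrictedProduct.ProductMeasureRestrict
import Literature.MeasureTheory.RestrictedProduct.Borel
import Mathlib.MeasureTheory.Group.Action
import Mathlib.MeasureTheory.Measure.Typeclasses.Finite
import HarnessLib

/-!
# Restricted product measures, X: invariance under coordinatewise group ACTIONS, finiteness on compacta,
# mass of the cylinders (the restricted product of local invariant measures on homogeneous data)

Topic `MeasureTheory/RestrictedProduct`; continues `ProductMeasureRestrict` (product formula and uniqueness of
`rpMeasure`) and `LeftInvariant` (the case of a group acting on itself). THEOREMS ONLY (no definition, no
instance).

Setting: countably many measurable spaces `X i` with base sets `C i ⊆ X i` and σ-finite local measures `m i`,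
`m i (C i) = 1` off a finite `S₀`; `μ = rpMeasure C m S₀` is the restricted product measure `∏'_i (m_i ; C_i)` on
`Πʳ i, [X i, C i]` (Tate's thesis, Cassels–Fröhlich (1967) Ch. XV §3.3; Guichardet (1972) App. D §D.3). The new
points, needed when the `X i` are HOMOGENEOUS SPACES `G_i ⧸ H_i` rather than groups (orbital integrals over
`G(𝔸) ⧸ G_γ(𝔸) = Πʳ_v G_v ⧸ G_{γ,v}`, Borel–Jacquet (1979) §4.1):

* `measurable_of_forall_apply_eq` — a map `Φ : Πʳ [X_i, C_i] → Πʳ [Y_i, D_i]` given coordinatewise by measurable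
  `f_i` (`(Φ z)_i = f_i(z_i)`) is measurable for the trace σ-algebras;
* **`map_eq_rpMeasure_of_forall_apply_eq_smul`** — INVARIANCE: if groups `G i` act measurably on the `X i`
  (`MeasurableConstSMul`), the `m i` are `G i`-invariant (`SMulInvariantMeasure`) and the base sets are stable
  under subgroups `B i` (`k • C_i = C_i`, `k ∈ B_i`), then for every `a ∈ ∏_i G_i` with `a_i ∈ B_i` for almost
  all `i`, every map `Φ` of the restricted product with `(Φ z)_i = a_i • z_i` preserves `μ`: `Φ_* μ = μ`
  (proof: compare restrictions to the cylinders `A_S`, `S ⊇ S₀ ∪ {i | a_i ∉ B_i}`, through the level measures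
  `λ_S = (∏_{i∈S} m_i) ⊗ (⨂_{i∉S} m_i|C_i)`, each factor being invariant: `map_smul_locK`, `map_smul_level`);
* `exists_subset_rpBox_of_isCompact` — for OPEN `C i` every compact subset of `Πʳ [X_i, C_i]` lies in a cylinder
  `A_S`; `rpMeasure_le_prod_image_eval` — `μ(Q) ≤ ∏_{i∈S} m_i(pr_i Q)` for `Q ⊆ A_S`;
  **`isFiniteMeasureOnCompacts_rpMeasure`** — `μ` is finite on compacta when the `m i` are;
* `rpMeasure_rpBox_eq_prod` — `μ(A_S) = ∏_{i∈S} m_i(X_i)` (`S ⊇ S₀`); **`rpMeasure_ne_zero`** — `μ ≠ 0` as soon as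
  `m_i ≠ 0` for `i ∈ S₀`.

Together with `SMulInvariantMeasure`-packaging downstream these are the three properties («invariant, finite on
compacta, non-zero») that the tree's orbital-term pins (`UnitaryGroup.IsOrbitalTerms`) demand of orbital
measures. Written for the cell `pub/hodgecm-mathlib`, ENGINE T1, plan O13c (file Q1c-A).

## References

* J. W. S. Cassels, A. Fröhlich (eds.), *Algebraic Number Theory* (1967), Ch. XV (Tate), §3.3 [CasselsFrohlichANT1967].
* A. Guichardet, *Symmetric Hilbert spaces and related topics*, LNM 261 (1972), App. D §D.3 [Guichardet1972].
* A. Borel, H. Jacquet, *Automorphic forms and automorphic representations*, PSPM 33.1 (1979), §4.1 [BorelJacquet1979].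
-/

noncomputable section

open _root_.MeasureTheory Set Filter Function
open _root_.Topology

open scoped RestrictedProduct ENNReal Pointwise

namespace Literature.MeasureTheory.RestrictedProduct

universe u v w

variable {ι : Type u} {X : ι → Type v} [∀ i, MeasurableSpace (X i)]
  (C : ∀ i, Set (X i)) (m : ∀ i, Measure (X i))

/-! ## Maps given coordinatewise are measurable -/

section MeasurableMap

variable {Y : ι → Type w} [∀ i, MeasurableSpace (Y i)] (D : ∀ i, Set (Y i))

/-- A map of restricted products given coordinatewise by measurable maps, `(Φ z)_i = f_i(z_i)`, is measurable
for the trace σ-algebras (countable index set, measurable base sets). [cite: CasselsFrohlichANT1967, Ch. XV (Tate) §3.3] -/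
theorem measurable_of_forall_apply_eq [Countable ι] (hCm : ∀ i, MeasurableSet (C i))
    (hDm : ∀ i, MeasurableSet (D i)) (f : ∀ i, X i → Y i) (hf : ∀ i, Measurable (f i))
    (Φ : (Πʳ i, [X i, C i]) → Πʳ i, [Y i, D i]) (hΦ : ∀ z i, Φ z i = f i (z i)) : Measurable Φ := by
  refine (measurableEmbedding_incl D hDm).measurable_comp_iff.1 ?_
  have hcomp : incl D ∘ Φ = (fun (x : Π i, X i) i => f i (x i)) ∘ incl C :=
    funext fun z => funext fun i => hΦ z i
  rw [hcomp]
  exact (measurable_pi_lambda _ fun i => (hf i).comp (measurable_pi_apply i)).comp (measurable_incl C hCm)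

end MeasurableMap

/-! ## Invariance under coordinatewise actions -/

section Invariance

variable {G : ι → Type w} [∀ i, Group (G i)] [∀ i, MulAction (G i) (X i)] [∀ i, MeasurableConstSMul (G i) (X i)]
  (B : ∀ i, Subgroup (G i))

/-- The local mass-one factor `m_i|_{C_i}` is invariant under `k ∈ B_i` when `m_i` is `G_i`-invariant and
`k • C_i = C_i`. [cite: CasselsFrohlichANT1967, Ch. XV (Tate) §3.3] -/
theorem map_smul_locK {i : ι} [SMulInvariantMeasure (G i) (X i) (m i)] (hCm : MeasurableSet (C i))
    (hBC : ∀ k ∈ B i, k • C i = C i) {k : G i} (hk : k ∈ B i) :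
    (locK C m i).map (fun x => k • x) = locK C m i := by
  have hpre : (fun x : X i => k • x) ⁻¹' C i = C i := by
    rw [Set.preimage_smul, hBC k⁻¹ ((B i).inv_mem hk)]
  calc (locK C m i).map (fun x => k • x)
      = ((m i).restrict ((fun x : X i => k • x) ⁻¹' C i)).map (fun x => k • x) := by rw [hpre]; rfl
    _ = ((m i).map (fun x => k • x)).restrict (C i) := (Measure.restrict_map (measurable_const_smul k) hCm).symm
    _ = locK C m i := by rw [MeasureTheory.map_smul]; rfl

/-- **Invariance of the level measures**: for `a ∈ ∏_i G_i` with `a_i ∈ B_i` off `S`, the level measure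
`λ_S = (∏_{i∈S} m_i) ⊗ (⨂_{i∉S} m_i|C_i)` on `Π i, X i` is invariant under `x ↦ (a_i • x_i)_i` (`m_i`
invariant, `B_i • C_i = C_i`, `m_i(C_i) = 1` off `S`). [cite: CasselsFrohlichANT1967, Ch. XV (Tate) §3.3] -/
theorem map_smul_level [∀ i, SigmaFinite (m i)] [∀ i, SMulInvariantMeasure (G i) (X i) (m i)] (hCm : ∀ i, MeasurableSet (C i)) (hBC : ∀ i, ∀ k ∈ B i, k • C i = C i)
    {S : Finset ι} (hC1 : ∀ i, i ∉ S → m i (C i) = 1) (a : Π i, G i) (ha : ∀ i, i ∉ S → a i ∈ B i) :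
    (level C m S).map (fun (x : Π i, X i) i => a i • x i) = level C m S := by
  haveI : ∀ i : {i // i ∉ S}, IsProbabilityMeasure (locK C m i) :=
    fun i => isProbabilityMeasure_locK C m (hC1 i i.2)
  have hΨ : Measurable (fun (x : Π i, X i) i => a i • x i) :=
    measurable_pi_lambda _ fun i => (measurable_const_smul (a i)).comp (measurable_pi_apply i)
  have hΨ₁ : Measurable (fun (y : (i : {i // i ∈ S}) → X i) (i : {i // i ∈ S}) => a i • y i) :=
    measurable_pi_lambda _ fun i => (measurable_const_smul (a i)).comp (measurable_pi_apply i)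
  have hΨ₂ : Measurable (fun (z : (i : {i // i ∉ S}) → X i) (i : {i // i ∉ S}) => a i • z i) :=
    measurable_pi_lambda _ fun i => (measurable_const_smul (a i)).comp (measurable_pi_apply i)
  have hcomm : (fun (x : Π i, X i) i => a i • x i) ∘ (split (G := X) S).symm =
      (split (G := X) S).symm ∘ Prod.map (fun y (i : {i // i ∈ S}) => a i • y i)
        (fun z (i : {i // i ∉ S}) => a i • z i) := by
    funext p
    funext i
    simp only [comp_apply]
    by_cases hi : i ∈ S
    · rw [split_symm_apply_of_mem (G := X) S _ hi, split_symm_apply_of_mem (G := X) S _ hi]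
      rfl
    · rw [split_symm_apply_of_not_mem (G := X) S _ hi, split_symm_apply_of_not_mem (G := X) S _ hi]
      rfl
  haveI : ∀ i : {i // i ∈ S}, SigmaFinite ((m i).map (fun x : X i => a i • x)) := fun i => by
    rw [MeasureTheory.map_smul]; infer_instance
  rw [level, Measure.map_map hΨ (measurable_split_symm S), hcomm,
    ← Measure.map_map (measurable_split_symm S) (hΨ₁.prodMap hΨ₂),
    ← Measure.map_prod_map _ _ hΨ₁ hΨ₂,
    Measure.pi_map_pi (fun i : {i // i ∈ S} => (measurable_const_smul (a i.1)).aemeasurable),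
    Measure.infinitePi_map_pi (fun i : {i // i ∉ S} => locK C m i)
      (fun i : {i // i ∉ S} => measurable_const_smul (a i.1))]
  have h1 : (fun i : {i // i ∈ S} => (m i).map (fun x : X i => a i • x)) = fun i : {i // i ∈ S} => m i :=
    funext fun i => MeasureTheory.map_smul (a i.1) (m i.1)
  have h2 : (fun i : {i // i ∉ S} => (locK C m i).map (fun x : X i => a i • x)) =
      fun i : {i // i ∉ S} => locK C m i :=
    funext fun i => map_smul_locK C m B (hCm i.1) (hBC i.1) (ha i.1 i.2)
  rw [h1, h2]

variable [Countable ι] [∀ i, SigmaFinite (m i)] [∀ i, SMulInvariantMeasure (G i) (X i) (m i)]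

omit [∀ i, MeasurableSpace (X i)] [∀ i, MeasurableConstSMul (G i) (X i)] [Countable ι]
  [∀ i, SigmaFinite (m i)] [∀ i, SMulInvariantMeasure (G i) (X i) (m i)] in
/-- A coordinatewise map `(Φ z)_i = a_i • z_i` with `a_i ∈ B_i` off `S` preserves the cylinder `A_S`
(`B_i • C_i = C_i`). [cite: CasselsFrohlichANT1967, Ch. XV (Tate) §3.3] -/
theorem preimage_rpBox_of_forall_apply_eq_smul (hBC : ∀ i, ∀ k ∈ B i, k • C i = C i) {S : Finset ι}
    (a : Π i, G i) (ha : ∀ i, i ∉ S → a i ∈ B i)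
    (Φ : (Πʳ i, [X i, C i]) → Πʳ i, [X i, C i]) (hΦ : ∀ z i, Φ z i = a i • z i) :
    Φ ⁻¹' rpBox C S = rpBox C S := by
  ext z
  simp only [mem_preimage, rpBox, mem_setOf_eq]
  refine forall₂_congr fun i hi => ?_
  rw [hΦ z i, ← Set.mem_inv_smul_set_iff, hBC i (a i)⁻¹ ((B i).inv_mem (ha i hi))]

omit [∀ i, SigmaFinite (m i)] [∀ i, SMulInvariantMeasure (G i) (X i) (m i)] in
/-- A coordinatewise map `(Φ z)_i = a_i • z_i` is measurable. [cite: CasselsFrohlichANT1967, Ch. XV (Tate) §3.3] -/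
theorem measurable_of_forall_apply_eq_smul (hCm : ∀ i, MeasurableSet (C i)) (a : Π i, G i)
    (Φ : (Πʳ i, [X i, C i]) → Πʳ i, [X i, C i]) (hΦ : ∀ z i, Φ z i = a i • z i) : Measurable Φ :=
  measurable_of_forall_apply_eq C C hCm hCm (fun i (x : X i) => a i • x) (fun i => measurable_const_smul (a i))
    Φ hΦ

/-- **The restricted product of invariant measures is invariant under coordinatewise actions.** Let groups
`G i` act measurably on the `X i`, leaving the local measures `m i` invariant, and let subgroups `B i`
stabilise the base sets (`k • C_i = C_i` for `k ∈ B_i`). Then for every `a ∈ ∏_i G_i` with `a_i ∈ B_i` for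
almost all `i`, every map `Φ` of `Πʳ i, [X i, C i]` given by `(Φ z)_i = a_i • z_i` satisfies
`Φ_* (∏'_i (m_i ; C_i)) = ∏'_i (m_i ; C_i)` — the invariance of the product measure on the adelic
homogeneous space `Πʳ_v G_v ⧸ G_{γ,v}` under `G(𝔸)`. (The group case `X_i = G_i` is `LeftInvariant`.)
[cite: CasselsFrohlichANT1967, Ch. XV (Tate) §3.3] -/
theorem map_eq_rpMeasure_of_forall_apply_eq_smul (hCm : ∀ i, MeasurableSet (C i))
    (hBC : ∀ i, ∀ k ∈ B i, k • C i = C i) {S₀ : Finset ι} (hC1 : ∀ i, i ∉ S₀ → m i (C i) = 1)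
    (a : Π i, G i) (ha : ∀ᶠ i in cofinite, a i ∈ B i)
    (Φ : (Πʳ i, [X i, C i]) → Πʳ i, [X i, C i]) (hΦ : ∀ z i, Φ z i = a i • z i) :
    (rpMeasure C m S₀).map Φ = rpMeasure C m S₀ := by
  classical
  have hfin : {i | ¬ (a i ∈ B i)}.Finite := Filter.eventually_cofinite.1 ha
  have haT : ∀ i, i ∉ hfin.toFinset → a i ∈ B i :=
    fun i hi => by_contra fun h => hi (hfin.mem_toFinset.2 h)
  have hΦm : Measurable Φ := measurable_of_forall_apply_eq_smul C hCm a Φ hΦ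
  have hemb := measurableEmbedding_incl C hCm
  have hΨ : Measurable (fun (x : Π i, X i) i => a i • x i) :=
    measurable_pi_lambda _ fun i => (measurable_const_smul (a i)).comp (measurable_pi_apply i)
  refine ext_of_restrict_rpBox C (S₀ ∪ hfin.toFinset) fun S hS => ?_
  have hS₀ : S₀ ⊆ S := Finset.union_subset_left hS
  have haS : ∀ i, i ∉ S → a i ∈ B i :=
    fun i hi => haT i fun h => hi (hS (Finset.mem_union_right _ h))
  have hC1S : ∀ i, i ∉ S → m i (C i) = 1 := fun i hi => hC1 i fun h => hi (hS₀ h)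
  rw [Measure.restrict_map hΦm (measurableSet_rpBox C hCm S),
    preimage_rpBox_of_forall_apply_eq_smul C B hBC a haS Φ hΦ]
  -- compare after pushing to `Π i, X i` along the measurable embedding `incl`
  have hcomp : incl C ∘ Φ = (fun (x : Π i, X i) i => a i • x i) ∘ incl C :=
    funext fun z => funext fun i => hΦ z i
  have key : (((rpMeasure C m S₀).restrict (rpBox C S)).map Φ).map (incl C) =
      ((rpMeasure C m S₀).restrict (rpBox C S)).map (incl C) := by
    rw [Measure.map_map hemb.measurable hΦm, hcomp, ← Measure.map_map hΨ hemb.measurable,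
      map_incl_rpMeasure_restrict C m hCm hC1 hS₀, map_smul_level C m B hCm hBC hC1S a haS]
  rw [← hemb.comap_map (((rpMeasure C m S₀).restrict (rpBox C S)).map Φ), key, hemb.comap_map]

end Invariance

/-! ## Finiteness on compacta (open base sets) -/

section Compact

variable [∀ i, TopologicalSpace (X i)]

omit [∀ i, MeasurableSpace (X i)] in
/-- For OPEN base sets, every compact subset of `Πʳ i, [X i, C i]` lies in some cylinder
`A_S = {z | z_i ∈ C_i, i ∉ S}` with `S ⊇ S₀` (the open cylinders are directed and cover). [cite: CasselsFrohlichANT1967, Ch. XV (Tate) §3.3] -/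
theorem exists_subset_rpBox_of_isCompact (hCo : ∀ i, IsOpen (C i)) (S₀ : Finset ι)
    {Q : Set (Πʳ i, [X i, C i])} (hQ : IsCompact Q) : ∃ S : Finset ι, S₀ ⊆ S ∧ Q ⊆ rpBox C S := by
  classical
  have hopen : ∀ T : Finset ι, IsOpen (rpBox C (S₀ ∪ T)) := fun T =>
    RestrictedProduct.isOpen_forall_imp_mem hCo
  have hcov : Q ⊆ ⋃ T : Finset ι, rpBox C (S₀ ∪ T) := by
    rw [iUnion_rpBox_union C S₀]
    exact subset_univ Q
  have hdir : Directed (· ⊆ ·) fun T : Finset ι => rpBox C (S₀ ∪ T) := fun T T' =>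
    ⟨T ∪ T', rpBox_mono C (Finset.union_subset_union (le_refl S₀) Finset.subset_union_left),
      rpBox_mono C (Finset.union_subset_union (le_refl S₀) Finset.subset_union_right)⟩
  obtain ⟨T, hT⟩ := hQ.elim_directed_cover _ hopen hcov hdir
  exact ⟨S₀ ∪ T, Finset.subset_union_left, hT⟩

variable [Countable ι] [∀ i, SigmaFinite (m i)]

omit [∀ i, TopologicalSpace (X i)] in
/-- **Cylinder bound**: for `Q ⊆ A_S` (`S ⊇ S₀`), `μ(Q) ≤ ∏_{i∈S} m_i(pr_i Q)` — from the product formula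
`μ|_{A_S} = (e_S)_* ((∏_{i∈S} m_i) ⊗ ρ_S)`, `ρ_S` a probability measure. [cite: CasselsFrohlichANT1967, Ch. XV (Tate) §3.3] -/
theorem rpMeasure_le_prod_image_eval (hCne : ∀ i, (C i).Nonempty) (hCm : ∀ i, MeasurableSet (C i))
    {S₀ : Finset ι} (hC1 : ∀ i, i ∉ S₀ → m i (C i) = 1) {S : Finset ι} (hS : S₀ ⊆ S)
    {Q : Set (Πʳ i, [X i, C i])} (hQ : Q ⊆ rpBox C S) :
    rpMeasure C m S₀ Q ≤ ∏ i : {i // i ∈ S}, m i ((fun z : Πʳ i, [X i, C i] => z (i : ι)) '' Q) := by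
  haveI := isProbabilityMeasure_rho C m hCne hCm S
  have h1 : rpMeasure C m S₀ Q = (rpMeasure C m S₀).restrict (rpBox C S) Q := by
    rw [Measure.restrict_apply' (measurableSet_rpBox C hCm S), inter_eq_left.2 hQ]
  rw [h1, rpMeasure_restrict_rpBox C m hCne hCm hC1 hS, (measurableEmbedding_glue C hCne hCm S).map_apply]
  have hsub : glue C S ⁻¹' Q ⊆
      (univ.pi fun i : {i // i ∈ S} => (fun z : Πʳ i, [X i, C i] => z (i : ι)) '' Q) ×ˢ univ := by
    intro p hp
    refine ⟨fun i _ => ⟨glue C S p, hp, ?_⟩, mem_univ _⟩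
    exact glue_apply_of_mem C S p i.2
  refine (measure_mono hsub).trans ?_
  rw [Measure.prod_prod, measure_univ (μ := rho C m hCne S), mul_one, Measure.pi_pi]

/-- **The restricted product measure is finite on compacta** when the base sets are open and the local
measures are finite on compacta (with `m_i(C_i) = 1` off `S₀`): a compact `Q` lies in some `A_S`, and
`μ(Q) ≤ ∏_{i∈S} m_i(pr_i Q) < ∞`. [cite: CasselsFrohlichANT1967, Ch. XV (Tate) §3.3] -/
theorem isFiniteMeasureOnCompacts_rpMeasure (hCo : ∀ i, IsOpen (C i)) (hCne : ∀ i, (C i).Nonempty)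
    (hCm : ∀ i, MeasurableSet (C i)) {S₀ : Finset ι} (hC1 : ∀ i, i ∉ S₀ → m i (C i) = 1)
    [∀ i, IsFiniteMeasureOnCompacts (m i)] : IsFiniteMeasureOnCompacts (rpMeasure C m S₀) := by
  refine ⟨fun Q hQ => ?_⟩
  obtain ⟨S, hS, hQS⟩ := exists_subset_rpBox_of_isCompact C hCo S₀ hQ
  refine (rpMeasure_le_prod_image_eval C m hCne hCm hC1 hS hQS).trans_lt ?_
  refine ENNReal.prod_lt_top fun i _ => ?_
  exact (hQ.image (RestrictedProduct.continuous_eval (i : ι))).measure_lt_top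

end Compact

/-! ## Mass of the cylinders; non-vanishing -/

section Mass

variable [Countable ι] [∀ i, SigmaFinite (m i)]

/-- **Mass of a cylinder**: `μ(A_S) = ∏_{i∈S} m_i(X_i)` for `S ⊇ S₀`. [cite: CasselsFrohlichANT1967, Ch. XV (Tate) §3.3] -/
theorem rpMeasure_rpBox_eq_prod (hCne : ∀ i, (C i).Nonempty) (hCm : ∀ i, MeasurableSet (C i))
    {S₀ : Finset ι} (hC1 : ∀ i, i ∉ S₀ → m i (C i) = 1) {S : Finset ι} (hS : S₀ ⊆ S) :
    rpMeasure C m S₀ (rpBox C S) = ∏ i ∈ S, m i univ := by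
  haveI := isProbabilityMeasure_rho C m hCne hCm S
  rw [← Measure.restrict_apply_univ, rpMeasure_restrict_rpBox C m hCne hCm hC1 hS,
    Measure.map_apply (measurable_glue C hCm S) MeasurableSet.univ, preimage_univ, ← univ_prod_univ,
    Measure.prod_prod, measure_univ (μ := rho C m hCne S), mul_one, Measure.pi_univ]
  exact Finset.prod_coe_sort S (fun i => m i univ)

/-- The total mass: `μ(Πʳ) ≥ μ(A_{S₀}) = ∏_{i∈S₀} m_i(X_i)`. [cite: CasselsFrohlichANT1967, Ch. XV (Tate) §3.3] -/
theorem prod_le_rpMeasure_univ (hCne : ∀ i, (C i).Nonempty) (hCm : ∀ i, MeasurableSet (C i))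
    {S₀ : Finset ι} (hC1 : ∀ i, i ∉ S₀ → m i (C i) = 1) :
    ∏ i ∈ S₀, m i univ ≤ rpMeasure C m S₀ univ := by
  rw [← rpMeasure_rpBox_eq_prod C m hCne hCm hC1 (Finset.Subset.refl S₀)]
  exact measure_mono (subset_univ _)

/-- **Non-vanishing**: the restricted product measure is non-zero as soon as the local measures at the places
of `S₀` are (off `S₀`, `m_i(C_i) = 1` forces it). [cite: CasselsFrohlichANT1967, Ch. XV (Tate) §3.3] -/
theorem rpMeasure_ne_zero (hCne : ∀ i, (C i).Nonempty) (hCm : ∀ i, MeasurableSet (C i))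
    {S₀ : Finset ι} (hC1 : ∀ i, i ∉ S₀ → m i (C i) = 1) (hm : ∀ i, i ∈ S₀ → m i ≠ 0) :
    rpMeasure C m S₀ ≠ 0 := by
  intro h0
  have hprod : ∏ i ∈ S₀, m i univ ≠ 0 :=
    Finset.prod_ne_zero_iff.2 fun i hi => by
      rw [Ne, Measure.measure_univ_eq_zero]
      exact hm i hi
  have hle := prod_le_rpMeasure_univ C m hCne hCm hC1
  rw [h0, Measure.coe_zero, Pi.zero_apply, nonpos_iff_eq_zero] at hle
  exact hprod hle

end Mass

end Literature.MeasureTheory.RestrictedProduct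

end
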